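import Summits.Ventures.QEC.Census.RefinedSubgroupConstraints
import HarnessLib

/-!
# CRSS's refined LP of the pair `(C, C′)` strengthened by subgroup orders and the quadratic parity count

Venture QEC (cell `qec`, LADDER-QEC rung X1; row 06). OUR strengthening of the refined system of
[CalderbankEtAl1998, §7 (ii)] for the pair `(C, C′)` (`RefinedLPBoundEvenSubcode.lean`, `CRSSRefinedPairFeasible`)
with three further clauses on the refined distributions `R = refDist C u₀`, `R′ = refDist C⊥ u₀`, all PROVED in
`RefinedSubgroupConstraints.lean` for every additive code and every reference word `u₀`:
`K = Σ_{a,b} R(a,b,0)` (codewords with `c = 0`) is a power of two; `K′ = Σ_b R′(0,b,0)` (dual words with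
`a = c = 0`) is a power of two [folklore subgroup orders; cf. LaiAshikhmin2018, §5.1]; and the number
`Z = Σ_{a even, b, c} R(a,b,c)` of codewords with even off-support weight satisfies `(2Z − 2^{n−k})² ∈ {0} ∪ {2^j}`
[MacWilliamsSloane1977, Ch. 15 §2 Thm. 5 (zeros of a quadratic form over GF(2))]. These are not linear constraints;
The certificates use them as GAP SPLITS (`RefinedQuadCertificate.lean`).

* `CRSSRefinedQuadFeasible n k d w₀` — the strengthened system; `crssRefinedQuadFeasible_of_isAdditiveCode` — every
  additive code with a codeword of even weight `w₀` solves it; `wtDist_eq_zero_of_not_crssRefinedQuadFeasible`.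

HONEST FRAMING: necessary conditions for existence; nothing here certifies a distance. References: [CalderbankEtAl1998]
§7 (ii)–(iii) (printed p. 28); [MacWilliamsSloane1977] Ch. 15 §2; [LaiAshikhmin2018] IEEE Trans. Inform. Theory 64
(2018) 622–639, §5.1.
-/

namespace Summit.Ventures.QEC.Census

open Finset Literature.InformationTheory.QuantumCodes

/-- **CRSS's refined LP of the pair `(C, C′)` with subgroup orders and the quadratic parity count.** The clauses of
`CRSSRefinedPairFeasible n k d w₀` on `(A, B, W, e, R, R′, R″)` together with: `Σ_{a ≤ n−w₀, b ≤ w₀} R(a,b,0) = 2^j`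
for some `j`; `Σ_{b ≤ w₀} R′(0,b,0) = 2^j` for some `j`; and, for `Z = Σ_{a ≤ n−w₀ even, b, c ≤ w₀} R(a,b,c)`,
`(2Z − 2^{n−k})² = 0` or `= 2^j` for some `j`. Column: definition.
[cite: CalderbankEtAl1998, §7 (ii) (printed p. 28); MacWilliamsSloane1977, Ch. 15 §2 Thm. 5; LaiAshikhmin2018, §5.1] -/
def CRSSRefinedQuadFeasible (n k d w₀ : ℕ) : Prop :=
  ∃ (A B W : ℕ → ℕ) (e : ℕ) (R R' R'' : ℕ → ℕ → ℕ → ℕ),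
    CRSSIntSystem n k d A B W e ∧ CRSSRefinedSystem n k d w₀ A B R R' ∧
      CRSSRefinedSystem n (k + e) 1 w₀ (evenPart A) W (evenPart₃ R) R'' ∧ (∀ a b c, R' a b c ≤ R'' a b c) ∧
      (∃ j : ℕ, ∑ a ∈ range (n - w₀ + 1), ∑ b ∈ range (w₀ + 1), R a b 0 = 2 ^ j) ∧
      (∃ j : ℕ, ∑ b ∈ range (w₀ + 1), R' 0 b 0 = 2 ^ j) ∧
      ((2 * ((∑ a ∈ (range (n - w₀ + 1)).filter Even, ∑ b ∈ range (w₀ + 1), ∑ c ∈ range (w₀ + 1), R a b c : ℕ) : ℤ)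
          - 2 ^ (n - k)) ^ 2 = 0 ∨
        ∃ j : ℕ, (2 * ((∑ a ∈ (range (n - w₀ + 1)).filter Even, ∑ b ∈ range (w₀ + 1), ∑ c ∈ range (w₀ + 1),
          R a b c : ℕ) : ℤ) - 2 ^ (n - k)) ^ 2 = 2 ^ j)

section Proof

variable {n : ℕ}

open scoped Classical in
/-- `Σ_{a, b} refDist(a,b,0) = #{v ∈ C : c(v) = 0}`. [cite: CalderbankEtAl1998, §7 (ii) (printed p. 28)] -/
theorem sum_refDist_otherCnt_zero (S : Submodule (ZMod 2) (SympVec n)) (u₀ : SympVec n) :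
    ∑ a ∈ range (n - sympWeight u₀ + 1), ∑ b ∈ range (sympWeight u₀ + 1), refDist S u₀ a b 0 =
      #((codeWords S).filter fun v => otherCnt u₀ v = 0) := by
  have h := sum_codeWords_eq_sum_refDist S u₀ (fun _ _ c => if c = 0 then (1 : ℕ) else 0)
  simp only [smul_eq_mul, mul_ite, mul_one, mul_zero] at h
  rw [Finset.sum_boole] at h
  simp only [Nat.cast_id] at h
  rw [h]
  refine Finset.sum_congr rfl fun a _ => Finset.sum_congr rfl fun b _ => ?_
  rw [Finset.sum_ite_eq' (range (sympWeight u₀ + 1)) 0 (fun c => refDist S u₀ a b c), if_pos (by simp)]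

open scoped Classical in
/-- `Σ_b refDist(0,b,0) = #{v ∈ C : a(v) = 0 ∧ c(v) = 0}`. [cite: CalderbankEtAl1998, §7 (ii) (printed p. 28)] -/
theorem sum_refDist_offWt_otherCnt_zero (S : Submodule (ZMod 2) (SympVec n)) (u₀ : SympVec n) :
    ∑ b ∈ range (sympWeight u₀ + 1), refDist S u₀ 0 b 0 =
      #((codeWords S).filter fun v => offWt u₀ v = 0 ∧ otherCnt u₀ v = 0) := by
  have h := sum_codeWords_eq_sum_refDist S u₀ (fun a _ c => if a = 0 ∧ c = 0 then (1 : ℕ) else 0)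
  simp only [smul_eq_mul, mul_ite, mul_one, mul_zero] at h
  rw [Finset.sum_boole] at h
  simp only [Nat.cast_id] at h
  rw [h]
  symm
  rw [Finset.sum_eq_single_of_mem 0 (mem_range.2 (Nat.succ_pos _))]
  · refine Finset.sum_congr rfl fun b _ => ?_
    rw [Finset.sum_eq_single_of_mem 0 (mem_range.2 (Nat.succ_pos _))]
    · simp
    · intro c _ hc; simp [hc]
  · intro a _ ha
    exact Finset.sum_eq_zero fun b _ => Finset.sum_eq_zero fun c _ => by simp [ha]

open scoped Classical in
/-- `Σ_{a even, b, c} refDist(a,b,c) = #{v ∈ C : a(v) even}`. [cite: CalderbankEtAl1998, §7 (ii) (printed p. 28)] -/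
theorem sum_refDist_offWt_even (S : Submodule (ZMod 2) (SympVec n)) (u₀ : SympVec n) :
    ∑ a ∈ (range (n - sympWeight u₀ + 1)).filter Even, ∑ b ∈ range (sympWeight u₀ + 1),
      ∑ c ∈ range (sympWeight u₀ + 1), refDist S u₀ a b c = #((codeWords S).filter fun v => Even (offWt u₀ v)) := by
  have h := sum_codeWords_eq_sum_refDist S u₀ (fun a _ _ => if Even a then (1 : ℕ) else 0)
  simp only [smul_eq_mul, mul_ite, mul_one, mul_zero] at h
  rw [Finset.sum_boole] at h
  simp only [Nat.cast_id] at h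
  rw [h, Finset.sum_filter]
  refine Finset.sum_congr rfl fun a _ => ?_
  split_ifs with ha
  · rfl
  · symm
    exact Finset.sum_eq_zero fun b _ => Finset.sum_eq_zero fun c _ => rfl

open scoped Classical in
/-- **Every additive code containing a word `u₀` of EVEN weight `w₀` solves the strengthened system**: the pair
system (`IsAdditiveCode.crssRefinedPairFeasible`'s witnesses), the two subgroup orders
(`card_filter_otherCnt_eq_zero_pow`, `card_filter_offWt_otherCnt_eq_zero_pow` for `C⊥`) and the quadratic parity count
(`offWt_parity_count`, with `|C| = 2^{n−k}`). Column: PROVED.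
[cite: CalderbankEtAl1998, §7 (ii) (printed p. 28); MacWilliamsSloane1977, Ch. 15 §2 Thm. 5; LaiAshikhmin2018, §5.1] -/
theorem crssRefinedQuadFeasible_of_isAdditiveCode {k d w₀ : ℕ} {S : Submodule (ZMod 2) (SympVec n)}
    (h : IsAdditiveCode S k d) (hw1 : ∀ v ∈ S, sympWeight v ≠ 1) {u₀ : SympVec n} (hu₀ : u₀ ∈ S)
    (hw₀ : sympWeight u₀ = w₀) (hev : Even w₀) : CRSSRefinedQuadFeasible n k d w₀ := by
  subst hw₀
  have hNk : Module.finrank (ZMod 2) S = n - k := by have := h.2.1; omega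
  have hcard : #(codeWords S) = 2 ^ (n - k) := by rw [card_codeWords S, hNk]
  obtain ⟨j₁, hj₁⟩ := card_filter_otherCnt_eq_zero_pow S u₀
  obtain ⟨j₂, hj₂⟩ := card_filter_offWt_otherCnt_eq_zero_pow (sympDual S) u₀
  have hq := offWt_parity_count S u₀
  rw [hcard] at hq
  push_cast at hq
  refine ⟨_, _, _, _, _, _, _, h.crssIntSystem hw1, h.crssRefinedSystem hu₀, h.crssRefinedSystem_evenSub hu₀ hev,
    fun a b c => refDist_mono (sympDual_anti (evenSub_le S h.1)) u₀ a b c, ⟨j₁, ?_⟩, ⟨j₂, ?_⟩, ?_⟩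
  · rw [sum_refDist_otherCnt_zero, hj₁]
  · rw [sum_refDist_offWt_otherCnt_zero, hj₂]
  · rw [sum_refDist_offWt_even]
    exact hq

open scoped Classical in
/-- **The strengthened refined bound as a nonexistence principle.** If for an EVEN weight `w₀` the strengthened
system is infeasible, then no additive code (without weight-one stabilizer words) has a codeword of weight `w₀`.
Column: PROVED. [cite: CalderbankEtAl1998, §7 (ii)–(iii) (printed p. 28)] -/
theorem wtDist_eq_zero_of_not_crssRefinedQuadFeasible {k d w₀ : ℕ}
    {S : Submodule (ZMod 2) (SympVec n)} (h : IsAdditiveCode S k d) (hw1 : ∀ v ∈ S, sympWeight v ≠ 1)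
    (hev : Even w₀) (hno : ¬ CRSSRefinedQuadFeasible n k d w₀) : wtDist S w₀ = 0 := by
  rw [wtDist, Finset.card_eq_zero, Finset.filter_eq_empty_iff]
  intro v hv hvw
  exact hno (crssRefinedQuadFeasible_of_isAdditiveCode h hw1 (mem_codeWords.1 hv) hvw hev)

end Proof

end Summit.Ventures.QEC.Census
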